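import Literature.NumberTheory.EllipticCurves.Rank1Residual.X11RankOneCertificates.Instances
import Literature.NumberTheory.EllipticCurves.PAdicLFunctionNonsplitMultiplicativeExistenceProofs
import HarnessLib

/-!
# X11 at rank one beyond `p = 3` — the `Inputs` bundle from PUBLISHED named facts only

HONEST FRAMING (cell `b2b-bsdres`, verbatim): prove what is provable now; shrink each hard class to its
core with data; no claim beyond stated classes; the cell deletes COMBINATION-shaped classes from
PUBLISHED theorems only, the CONSTRUCTION-shaped remainder is typed; this is not "finishing BSD".

Theorems only. `Inputs` (`Claim.lean`) bundles the eleven hypotheses of the record theorems; its field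
`mttNonsplit` (existence of the `p`-adic `L`-function at a non-split multiplicative prime, the named
fact `exists_isMultPAdicLFunctionOf_neg_one` of `Claim.lean`) is now a tree THEOREM
(`exists_isMultPAdicLFunctionOf_neg_one_holds`, file `PAdicLFunctionNonsplitMultiplicativeExistenceProofs`).
`inputs_of_published` builds `Inputs` from the TEN remaining named facts — all published:
Kato's divisibility for surjective `ρ_{E,p^∞}` (Wuthrich 2014 Thm. 3 / Cor. 19 = Stein–Wuthrich 2013
Thm. 7.3; flag `Wu14-surj-attribution`), Skinner 2016 Thm. A, Stein–Wuthrich 2013 Thm. 6.1 (split /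
non-split), SW §4.2 height existence (split / non-split), Wuthrich 2014 Prop. 21,
Gross–Zagier–Kolyvagin, modularity (entire `L`; modular parametrisation) — so the trust base of
`bsdp_of_claims{1,2}` / `bsdp_of_certified_of_claims'` is exactly these ten facts + the record's
`Claim` + global minimality of the model. Per pair; no class label changes.
-/

set_option autoImplicit false

open WeierstrassCurve Literature.NumberTheory.EllipticCurves Literature.NumberTheory.EllipticCurves.ModularForms
  Literature.NumberTheory.EllipticCurves.Skinner2016 Literature.NumberTheory.EllipticCurves.Wuthrich2014
  Literature.NumberTheory.EllipticCurves.SteinWuthrich2013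

namespace Literature.NumberTheory.EllipticCurves.Rank1Residual.X11RankOneCertificates

/-- **`Inputs` from the ten published named facts** (the eleventh field, MTT non-split existence, is
the theorem `exists_isMultPAdicLFunctionOf_neg_one_holds`). [folklore] -/
theorem inputs_of_published
    (hK : kato_charIdeal_dvd_multiplicative_of_surjective) (hA : thmA_charIdeal_multiplicative)
    (hJs : thm61_splitMultiplicative) (hJn : thm61_nonsplitMultiplicative)
    (hHs : exists_isSplitMultCanonical) (hHn : exists_isMultCanonical)
    (hW : Wuthrich2014.sha_dvd_analyticSha) (hGZK : rank_eq_analyticRank_of_analyticRank_le_one)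
    (hmod : hasEntireLFunction_rat) (hpar : nonempty_modularParametrizationData) : Inputs :=
  ⟨hK, hA, hJs, hJn, hHs, hHn, hW, hGZK, hmod, hpar, exists_isMultPAdicLFunctionOf_neg_one_holds⟩

/-- **List form over the ten published facts**: for a `Certified` list of records whose claims hold,
`BSD(E,p)` for every listed pair (model assumed globally minimal). With `certified_records1` /
`certified_records2` this is the statement "BSD(E,p) for all 85 residue pairs of the class
X11 ∧ r = 1 ∧ ¬sst ∧ p ≥ 5 with N < 2·10⁴, from ten published theorems and the per-pair two-engine
computation". [folklore] -/
theorem bsdp_of_certified_of_claims_of_published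
    (hK : kato_charIdeal_dvd_multiplicative_of_surjective) (hA : thmA_charIdeal_multiplicative)
    (hJs : thm61_splitMultiplicative) (hJn : thm61_nonsplitMultiplicative)
    (hHs : exists_isSplitMultCanonical) (hHn : exists_isMultCanonical)
    (hW : Wuthrich2014.sha_dvd_analyticSha) (hGZK : rank_eq_analyticRank_of_analyticRank_le_one)
    (hmod : hasEntireLFunction_rat) (hpar : nonempty_modularParametrizationData)
    {rs : List Record} (hC : Certified rs) (hcl : Claims rs) (r : Record) (hr : r ∈ rs)
    [r.curve.IsGloballyMinimal] : BSDp r.curve r.p :=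
  bsdp_of_certified_of_claims' (inputs_of_published hK hA hJs hJn hHs hHn hW hGZK hmod hpar) hC hcl r hr

end Literature.NumberTheory.EllipticCurves.Rank1Residual.X11RankOneCertificates
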